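/-
Copyright: the b2b-balaban T⁴-continuum CRUX team, row NE7b OWNER lineage `t4-ne7b-p1` (gen 130). Project licence.
-/
import Mathlib.Analysis.Calculus.ParametricIntegral
import Mathlib.Analysis.SpecialFunctions.ExpDeriv
import Mathlib.Analysis.Complex.Exponential

/-!
# DIFFERENTIATING AN EXPONENTIAL TILT UNDER THE INTEGRAL: for a measure `μ`, a weight `Φ` and an observable `A` with ONE exponential-moment
# letter `∫|Φ|e^{K|A|}dμ < ∞`, the tilted integral `s ↦ ∫Φe^{sA}dμ` is differentiable at every `|s₀| ≤ K − 2` with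
#   `d∕ds ∫Φe^{sA}dμ |_{s₀} = ∫ΦAe^{s₀A}dμ`
# — dominated differentiation with the envelope `|ΦAe^{sA}| ≤ |Φ|e^{(|s₀|+2)|A|}` on the unit ball about `s₀` (`|a| ≤ e^{|a|}`); the weight
# `ΦA` inherits the letter with `K − 1`, so the lemma iterates (row NE7b, node U5c; Mathlib's `hasDerivAt_integral_of_dominated_loc_of_deriv_le`
# BY NAME; [folklore])

Cell `pub-balaban`, sub-cell `t4`, spine estimate NE7b (`T4WeightBudget.RelWeightBound`; the cell's OWN estimate — NOT PRINTED in
[Bałaban 1983–89], NOT PROVED).  Crux-route work under `Spine/NE7b/` by the row OWNER (`t4-ne7b-p1` gen 130, file (328)) under FREEZE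
(0)'s crux-prover clause, on § [NE7bP1-G129-HANDOFF] NEXT (i)∕(ii) (SCOPING-d4: the `(s,t)`-derivatives of `Z(s,t) = ∫e^{−V}e^{sF_y+tG_z}dN(0,Γ)`
— the exponential family through the tilted law — whose logarithmic derivatives are the tilted cumulants that (327) consumes); NOTHING of
Bałaban's is named as a Lean object, valued or asserted; no `T4Continuum/Support` leaf typed; no `def`, no notation; zero `sorry`.  Mathlib
only (`hasDerivAt_integral_of_dominated_loc_of_deriv_le`, `Real.add_one_le_exp`, `HasDerivAt.exp`, `Integrable.mono'`).

WHY (located).  (326) bounds mixed DIFFERENCES of `log Z(s,t)`; (327) converts differences into the mixed derivative given bounds on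
`∂_s²log Z` and `∂_t²∂_s log Z`; these are ratios of `(s,t)`-derivatives of `Z(s,t) = ∫e^{−V}e^{sA+tB}dμ`, an exponential family in two
one-site observables.  Every such derivative is one application of the present lemma with a weight `Φ = e^{−V}e^{tB}A^jB^k`, and all the
domination letters reduce to ONE exponential-moment letter of the Gaussian-regulated kind the road already owns ((297)∕(323)).

WHAT IS PROVED ([folklore]; `(Ω, μ)` any measure space, `Φ, A : Ω → ℝ` measurable):
* §1 `abs_le_exp_abs` (`|a| ≤ e^{|a|}`), `abs_mul_exp_mul_le` (`|s − s₀| ≤ 1 ⟹ |a|·e^{sa} ≤ e^{(|s₀|+2)|a|}`), `exp_mul_le_exp_abs`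
  (`|s| ≤ c ⟹ e^{sa} ≤ e^{c|a|}`);
* §2 `integrable_mul_exp_mul` (`∫|Φ|e^{K|A|} < ∞`, `|s| ≤ K` ⟹ `Φe^{sA}` integrable), `integrable_mul_mul_exp_mul` (`|s| + 1 ≤ K` ⟹ `ΦAe^{sA}`
  integrable), `integrable_abs_mul_mul_exp` (the letter is inherited by the weight `ΦA` with `K − 1`);
* §3 THE END **`hasDerivAt_integral_mul_exp`** (`∫|Φ|e^{K|A|} < ∞`, `|s₀| + 2 ≤ K` ⟹
  `HasDerivAt (s ↦ ∫Φe^{sA}dμ) (∫ΦAe^{s₀A}dμ) s₀`); §4 toy.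

HONEST (what this is NOT).  One real parameter and real weights; the road's instantiation (`Φ = e^{−V}e^{tB}A^jB^k` under `N(0,Γ)` with the
regulator supplying the letter) and the cumulant bounds are the successor's next files of SCOPING-d4; nothing of Bałaban's asserted.
BY-NAME EFFECT ON THE WALL: NONE.  NE7b NOT PRINTED ∕ NOT PROVED; spine PROVED 0∕9; rung (B)+1 — the programme's measures remain FINITE-torus
statements; NOT the mass gap, NOT Clay.  HONEST DEPENDENCY: continuum YM on T⁴ ⇐ BetaPertH ∧ nine spine estimates (0∕9 proved); BetaPertH ⇐
(D1) ∧ (D4) ∧ CAP+tail; G-an2-4 gates asym, D1 and NE2∕3∕4.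
-/

set_option autoImplicit false

noncomputable section

namespace Summit.QuantumFields.BalabanUV.T4Continuum.NE7b.SupExpFamilyDerivative

open MeasureTheory Real Set Filter Metric
open scoped Topology

variable {Ω : Type*} [MeasurableSpace Ω] {μ : Measure Ω}

/-! ## §1. Pointwise envelopes -/

/-- `|a| ≤ e^{|a|}`. [folklore] -/
theorem abs_le_exp_abs (a : ℝ) : |a| ≤ exp |a| := by linarith [add_one_le_exp |a|]

/-- `|s| ≤ c ⟹ e^{sa} ≤ e^{c|a|}`. [folklore] -/
theorem exp_mul_le_exp_abs {s c : ℝ} (hs : |s| ≤ c) (a : ℝ) : exp (s * a) ≤ exp (c * |a|) := by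
  refine exp_le_exp.2 ?_
  calc s * a ≤ |s * a| := le_abs_self _
    _ = |s| * |a| := abs_mul _ _
    _ ≤ c * |a| := mul_le_mul_of_nonneg_right hs (abs_nonneg _)

/-- **The derivative's envelope on the unit ball**: `|s − s₀| ≤ 1 ⟹ |a|·e^{sa} ≤ e^{(|s₀|+2)|a|}`. [folklore] -/
theorem abs_mul_exp_mul_le {s s₀ : ℝ} (hs : |s - s₀| ≤ 1) (a : ℝ) : |a| * exp (s * a) ≤ exp ((|s₀| + 2) * |a|) := by
  have hs' : |s| ≤ |s₀| + 1 := by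
    have := abs_sub_abs_le_abs_sub s s₀
    linarith
  calc |a| * exp (s * a) ≤ exp |a| * exp ((|s₀| + 1) * |a|) :=
        mul_le_mul (abs_le_exp_abs a) (exp_mul_le_exp_abs hs' a) (exp_pos _).le (exp_pos _).le
    _ = exp ((|s₀| + 2) * |a|) := by rw [← exp_add]; congr 1; ring

/-! ## §2. Integrability from one exponential-moment letter -/

/-- **`Φe^{sA}` is integrable** when `∫|Φ|e^{K|A|} < ∞` and `|s| ≤ K`. [folklore] -/
theorem integrable_mul_exp_mul {Φ A : Ω → ℝ} (hΦ : Measurable Φ) (hA : Measurable A) {K : ℝ}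
    (hdom : Integrable (fun ω => |Φ ω| * exp (K * |A ω|)) μ) {s : ℝ} (hs : |s| ≤ K) :
    Integrable (fun ω => Φ ω * exp (s * A ω)) μ := by
  refine hdom.mono' (hΦ.mul (measurable_exp.comp (hA.const_mul s))).aestronglyMeasurable (ae_of_all _ fun ω => ?_)
  rw [norm_mul, Real.norm_eq_abs, Real.norm_of_nonneg (exp_pos _).le]
  exact mul_le_mul_of_nonneg_left (exp_mul_le_exp_abs hs (A ω)) (abs_nonneg _)

/-- **`ΦAe^{sA}` is integrable** when `∫|Φ|e^{K|A|} < ∞` and `|s| + 1 ≤ K`. [folklore] -/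
theorem integrable_mul_mul_exp_mul {Φ A : Ω → ℝ} (hΦ : Measurable Φ) (hA : Measurable A) {K : ℝ}
    (hdom : Integrable (fun ω => |Φ ω| * exp (K * |A ω|)) μ) {s : ℝ} (hs : |s| + 1 ≤ K) :
    Integrable (fun ω => Φ ω * A ω * exp (s * A ω)) μ := by
  refine hdom.mono' ((hΦ.mul hA).mul (measurable_exp.comp (hA.const_mul s))).aestronglyMeasurable (ae_of_all _ fun ω => ?_)
  rw [norm_mul, norm_mul, Real.norm_eq_abs, Real.norm_eq_abs, Real.norm_of_nonneg (exp_pos _).le, mul_assoc]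
  refine mul_le_mul_of_nonneg_left ?_ (abs_nonneg _)
  calc |A ω| * exp (s * A ω) ≤ exp |A ω| * exp (|s| * |A ω|) :=
        mul_le_mul (abs_le_exp_abs _) (exp_mul_le_exp_abs le_rfl _) (exp_pos _).le (exp_pos _).le
    _ = exp ((|s| + 1) * |A ω|) := by rw [← exp_add]; congr 1; ring
    _ ≤ exp (K * |A ω|) := exp_le_exp.2 (mul_le_mul_of_nonneg_right hs (abs_nonneg _))

/-- **The letter is inherited by the weight `ΦA`** with `K − 1`: `∫|Φ|e^{K|A|} < ∞ ⟹ ∫|ΦA|e^{(K−1)|A|} < ∞`. [folklore] -/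
theorem integrable_abs_mul_mul_exp {Φ A : Ω → ℝ} (hΦ : Measurable Φ) (hA : Measurable A) {K : ℝ}
    (hdom : Integrable (fun ω => |Φ ω| * exp (K * |A ω|)) μ) :
    Integrable (fun ω => |Φ ω * A ω| * exp ((K - 1) * |A ω|)) μ := by
  have hmeas : AEStronglyMeasurable (fun ω => |Φ ω * A ω| * exp ((K - 1) * |A ω|)) μ :=
    ((continuous_abs.measurable.comp (hΦ.mul hA)).mul
      (measurable_exp.comp ((continuous_abs.measurable.comp hA).const_mul (K - 1)))).aestronglyMeasurable
  refine hdom.mono' hmeas (ae_of_all _ fun ω => ?_)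
  rw [Real.norm_of_nonneg (mul_nonneg (abs_nonneg _) (exp_pos _).le), abs_mul, mul_assoc]
  refine mul_le_mul_of_nonneg_left ?_ (abs_nonneg _)
  calc |A ω| * exp ((K - 1) * |A ω|) ≤ exp |A ω| * exp ((K - 1) * |A ω|) :=
        mul_le_mul_of_nonneg_right (abs_le_exp_abs _) (exp_pos _).le
    _ = exp (K * |A ω|) := by rw [← exp_add]; congr 1; ring

/-! ## §3. THE END: differentiating the tilt under the integral -/

/-- **THE END — DIFFERENTIATING AN EXPONENTIAL TILT UNDER THE INTEGRAL.**  `Φ, A` measurable,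
`∫|Φ|e^{K|A|}dμ < ∞`, `|s₀| + 2 ≤ K` ⟹ `HasDerivAt (s ↦ ∫Φ(ω)e^{sA(ω)}dμ) (∫Φ(ω)A(ω)e^{s₀A(ω)}dμ) s₀`. [folklore] -/
theorem hasDerivAt_integral_mul_exp {Φ A : Ω → ℝ} (hΦ : Measurable Φ) (hA : Measurable A) {K : ℝ}
    (hdom : Integrable (fun ω => |Φ ω| * exp (K * |A ω|)) μ) {s₀ : ℝ} (hs₀ : |s₀| + 2 ≤ K) :
    HasDerivAt (fun s => ∫ ω, Φ ω * exp (s * A ω) ∂μ) (∫ ω, Φ ω * A ω * exp (s₀ * A ω) ∂μ) s₀ := by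
  have hK : |s₀| ≤ K := by linarith [abs_nonneg s₀]
  have hmeasF : ∀ s, AEStronglyMeasurable (fun ω => Φ ω * exp (s * A ω)) μ := fun s =>
    (hΦ.mul (measurable_exp.comp (hA.const_mul s))).aestronglyMeasurable
  have hmeasF' : ∀ s, AEStronglyMeasurable (fun ω => Φ ω * A ω * exp (s * A ω)) μ := fun s =>
    ((hΦ.mul hA).mul (measurable_exp.comp (hA.const_mul s))).aestronglyMeasurable
  -- the envelope `|Φ|e^{(|s₀|+2)|A|} ≤ |Φ|e^{K|A|}`
  have hbound : Integrable (fun ω => |Φ ω| * exp ((|s₀| + 2) * |A ω|)) μ := by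
    refine hdom.mono' ((continuous_abs.measurable.comp hΦ).mul
      (measurable_exp.comp ((continuous_abs.measurable.comp hA).const_mul (|s₀| + 2)))).aestronglyMeasurable (ae_of_all _ fun ω => ?_)
    rw [Real.norm_of_nonneg (mul_nonneg (abs_nonneg _) (exp_pos _).le)]
    exact mul_le_mul_of_nonneg_left (exp_le_exp.2 (mul_le_mul_of_nonneg_right hs₀ (abs_nonneg _))) (abs_nonneg _)
  have key := hasDerivAt_integral_of_dominated_loc_of_deriv_le (μ := μ) (x₀ := s₀) (s := closedBall s₀ 1)
    (F := fun s ω => Φ ω * exp (s * A ω)) (F' := fun s ω => Φ ω * A ω * exp (s * A ω))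
    (bound := fun ω => |Φ ω| * exp ((|s₀| + 2) * |A ω|)) (closedBall_mem_nhds s₀ one_pos)
    (Eventually.of_forall hmeasF) (integrable_mul_exp_mul hΦ hA hdom hK) (hmeasF' s₀)
    (ae_of_all _ fun ω s hs => by
      rw [mem_closedBall, dist_eq_norm, Real.norm_eq_abs] at hs
      rw [norm_mul, norm_mul, Real.norm_eq_abs, Real.norm_eq_abs, Real.norm_of_nonneg (exp_pos _).le, mul_assoc]
      exact mul_le_mul_of_nonneg_left (abs_mul_exp_mul_le hs (A ω)) (abs_nonneg _))
    hbound
    (ae_of_all _ fun ω s _ => ((hasDerivAt_mul_const (A ω)).exp.const_mul (Φ ω)).congr_deriv (by ring))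
  exact key.2

/-! ## §4. Toy -/

/-- Toy (§1): `|−2| ≤ e^{|−2|}`. -/
example : |(-2 : ℝ)| ≤ exp |(-2 : ℝ)| := abs_le_exp_abs (-2)

end Summit.QuantumFields.BalabanUV.T4Continuum.NE7b.SupExpFamilyDerivative
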